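import Summits.NavierStokesRegularity.NavierStokesRegularity.Theorems.FrequencyRigidity.Negative.WitnessWobble
import Literature.Analysis.FluidPDE.LocalTypeI
import HarnessLib

/-!
# Crux `FrequencyRigidity` (stmt-NavierStokesRegularity-2955), line `scaled-energy-split`:
# Stub 1 `stub_frameNormalisation` — Galilean gauge fixing

Helper file (`--supports stmt-NavierStokesRegularity-2955`; theorems only, sorry-free).  Candidate proof by the
strategist `cstrat-stmt-NavierStokesRegularity-2955-p1` (2026-08-17), landed by lead c6.  Proves the registered stub
`stub_frameNormalisation` of `Cruxes/FrequencyRigidity/Lines/scaled_energy_split.lean` (skeleton v2) by name and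
signature: if no inhabitant of the crux body has finite Albritton–Barker quantity
`typeIBound (ℝ₋ × ℝ³) v q ∇v` in the GIVEN frame, then none has it in ANY smooth Galilean frame `B` with
Type-I velocity `‖B′(t)‖ ≤ C_B/√(−t)` ending at the pole.  Proof: the witness class is invariant under such
wobbles (`Negative.witness_wobble`, LANDED: `ũ = v(t, x − B) + B′`, `q̃ = q(t, x − B) − ⟪B″, x⟫`,
`K̃ = K(t, x − B)`, constants `C ↦ C + C_B`, `H̃ = H`, `Λ̃ = Λ`), and the frame predicate IS the frame-`0`
quantity of the wobbled triple (`Negative.fderiv_wobbleDrift`: `∇ũ(t)(x) = ∇v(t)(x − B(t))`).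
Pure bookkeeping over landed theorems.

## References

* G. Koch, N. Nadirashvili, G. Seregin, V. Šverák, *Liouville theorems for the Navier–Stokes equations and
  applications*, Acta Math. 203 (2009), §3 Lemma 3.1 (Galilean / parasitic gauge). [KochNadirashviliSereginSverak2009]
* D. Albritton, T. Barker, J. Math. Fluid Mech. 21 (2019), §1 (the quantity `𝐈`). [AlbrittonBarker2019]
-/

noncomputable section

set_option linter.dupNamespace false

namespace Summit.NavierStokesRegularity.NavierStokesRegularity.Theorems.FrequencyRigidity.ScaledEnergySplit

open Literature.Analysis.FluidPDE Literature.Analysis.UnboundedOperators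
open MeasureTheory Set Filter Topology Function
open scoped Laplacian InnerProductSpace RealInnerProductSpace ContDiff
open Summit.NavierStokesRegularity.NavierStokesRegularity.Theorems.FrequencyRigidity.Negative

/-- The raw crux body equals the conjunction of the clause bundles of `Negative/Clauses.lean`
(same `simp only` as `Negative.frequencyRigidity_iff`). -/
theorem body_iff_bundles (ν C Λ₀ : ℝ) (v : ℝ → EuclideanSpace ℝ (Fin 3) → EuclideanSpace ℝ (Fin 3))
    (q : ℝ → EuclideanSpace ℝ (Fin 3) → ℝ) (K : ℝ → EuclideanSpace ℝ (Fin 3) → ℝ) :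
    (0 < ν ∧ Literature.Analysis.FluidPDE.IsClassicalNSSolutionOn (Set.Iio 0) ν 0 v q ∧ (∀ t ∈ Set.Iio (0:ℝ), ∀ x, ‖v t x‖ ≤ C / Real.sqrt (-t)) ∧ ContDiffOn ℝ 2 (Function.uncurry K) (Set.Iio (0:ℝ) ×ˢ Set.univ) ∧ (∀ t ∈ Set.Iio (0:ℝ), ∀ x, 0 < K t x) ∧ (∀ t ∈ Set.Iio (0:ℝ), ∀ x, Literature.Analysis.FluidPDE.timeDerivWithin (Set.Iio (0:ℝ)) K t x + fderiv ℝ (K t) x (v t x) + ν * Laplacian.laplacian (K t) x = 0) ∧ (∀ t ∈ Set.Iio (0:ℝ), ∫ x, K t x = 1) ∧ (∀ φ : EuclideanSpace ℝ (Fin 3) → ℝ, Continuous φ → (∃ M : ℝ, ∀ x, |φ x| ≤ M) → Filter.Tendsto (fun t => ∫ x, φ x * K t x) (nhdsWithin (0:ℝ) (Set.Iio (0:ℝ))) (nhds (φ (0 : EuclideanSpace ℝ (Fin 3))))) ∧ (∃ c₁ c₂ C₁ C₂ : ℝ, 0 < c₁ ∧ 0 < c₂ ∧ 0 < C₁ ∧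 0 < C₂ ∧ ∀ t ∈ Set.Iio (0:ℝ), ∀ x, c₁ * ((0:ℝ) - t) ^ (-(3:ℝ) / 2) * Real.exp (-(‖x - (0 : EuclideanSpace ℝ (Fin 3))‖ ^ 2) / (c₂ * ((0:ℝ) - t))) ≤ K t x ∧ K t x ≤ C₁ * ((0:ℝ) - t) ^ (-(3:ℝ) / 2) * Real.exp (-(‖x - (0 : EuclideanSpace ℝ (Fin 3))‖ ^ 2) / (C₂ * ((0:ℝ) - t)))) ∧ (∀ H Λ : ℝ → ℝ, H = (fun t => ∫ x, ‖Literature.Analysis.FluidPDE.curl (v t) x‖ ^ 2 * K t x) → Λ = (fun t => (0 - t) * deriv H t / H t) → (∀ t ∈ Set.Iio (0:ℝ), 0 < H t) ∧ (∀ t ∈ Set.Iio (0:ℝ), Λ t = Λ₀))) ↔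
    (0 < ν ∧ IsClassicalNSSolutionOn (Iio 0) ν 0 v q ∧ TypeIBound C v ∧ KernelClauses ν v K ∧
      Comparable K ∧ FreqClause v K Λ₀) := by
  simp only [TypeIBound, KernelClauses, Comparable, FreqClause, and_assoc]

/-- **Stub 1 of line `scaled-energy-split` (`stub_frameNormalisation`), by name and registered signature**: the
frame-`0` finite-scaled-energy flat Liouville implies the frame-invariant one (wobble the putative inhabitant into its
frame; the body is invariant, `C ↦ C + C_B`, and the frame quantity is the frame-`0` quantity of the wobbled triple). [cite: KochNadirashviliSereginSverak2009, §3 Lemma 3.1] -/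
theorem stub_frameNormalisation : (¬ ∃ (ν C Λ₀ : ℝ) (v : ℝ → EuclideanSpace ℝ (Fin 3) → EuclideanSpace ℝ (Fin 3)) (q : ℝ → EuclideanSpace ℝ (Fin 3) → ℝ) (K : ℝ → EuclideanSpace ℝ (Fin 3) → ℝ), (0 < ν ∧ Literature.Analysis.FluidPDE.IsClassicalNSSolutionOn (Set.Iio 0) ν 0 v q ∧ (∀ t ∈ Set.Iio (0:ℝ), ∀ x, ‖v t x‖ ≤ C / Real.sqrt (-t)) ∧ ContDiffOn ℝ 2 (Function.uncurry K) (Set.Iio (0:ℝ) ×ˢ Set.univ) ∧ (∀ t ∈ Set.Iio (0:ℝ), ∀ x, 0 < K t x) ∧ (∀ t ∈ Set.Iio (0:ℝ), ∀ x, Literature.Analysis.FluidPDE.timeDerivWithin (Set.Iio (0:ℝ)) K t x + fderiv ℝ (K t) x (v t x) + ν * Laplacian.laplacian (K t) x = 0) ∧ (∀ t ∈ Set.Iio (0:ℝ), ∫ x, K t x = 1) ∧ (∀ φ : EuclideanSpace ℝ (Fin 3) → ℝ, Continuous φ → (∃ M : ℝ, ∀ x, |φ x| ≤ M) → Filter.Tendsto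 (fun t => ∫ x, φ x * K t x) (nhdsWithin (0:ℝ) (Set.Iio (0:ℝ))) (nhds (φ (0 : EuclideanSpace ℝ (Fin 3))))) ∧ (∃ c₁ c₂ C₁ C₂ : ℝ, 0 < c₁ ∧ 0 < c₂ ∧ 0 < C₁ ∧ 0 < C₂ ∧ ∀ t ∈ Set.Iio (0:ℝ), ∀ x, c₁ * ((0:ℝ) - t) ^ (-(3:ℝ) / 2) * Real.exp (-(‖x - (0 : EuclideanSpace ℝ (Fin 3))‖ ^ 2) / (c₂ * ((0:ℝ) - t))) ≤ K t x ∧ K t x ≤ C₁ * ((0:ℝ) - t) ^ (-(3:ℝ) / 2) * Real.exp (-(‖x - (0 : EuclideanSpace ℝ (Fin 3))‖ ^ 2) / (C₂ * ((0:ℝ) - t)))) ∧ (∀ H Λ : ℝ → ℝ, H = (fun t => ∫ x, ‖Literature.Analysis.FluidPDE.curl (v t) x‖ ^ 2 * K t x) → Λ = (fun t => (0 - t) * deriv H t / H t) → (∀ t ∈ Set.Iio (0:ℝ), 0 < H t) ∧ (∀ t ∈ Set.Iio (0:ℝ), Λ t = Λ₀))) ∧ Literature.Analysis.FluidPDE.typeIBound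 (Set.Iio (0:ℝ) ×ˢ Set.univ) v q (fun t x => fderiv ℝ (v t) x) < ⊤) → (¬ ∃ (ν C Λ₀ : ℝ) (v : ℝ → EuclideanSpace ℝ (Fin 3) → EuclideanSpace ℝ (Fin 3)) (q : ℝ → EuclideanSpace ℝ (Fin 3) → ℝ) (K : ℝ → EuclideanSpace ℝ (Fin 3) → ℝ), (0 < ν ∧ Literature.Analysis.FluidPDE.IsClassicalNSSolutionOn (Set.Iio 0) ν 0 v q ∧ (∀ t ∈ Set.Iio (0:ℝ), ∀ x, ‖v t x‖ ≤ C / Real.sqrt (-t)) ∧ ContDiffOn ℝ 2 (Function.uncurry K) (Set.Iio (0:ℝ) ×ˢ Set.univ) ∧ (∀ t ∈ Set.Iio (0:ℝ), ∀ x, 0 < K t x) ∧ (∀ t ∈ Set.Iio (0:ℝ), ∀ x, Literature.Analysis.FluidPDE.timeDerivWithin (Set.Iio (0:ℝ)) K t x + fderiv ℝ (K t) x (v t x) + ν * Laplacian.laplacian (K t) x = 0) ∧ (∀ t ∈ Set.Iio (0:ℝ), ∫ x, K t x = 1) ∧ (∀ φ : EuclideanSpace ℝ (Fin 3) → ℝ,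 Continuous φ → (∃ M : ℝ, ∀ x, |φ x| ≤ M) → Filter.Tendsto (fun t => ∫ x, φ x * K t x) (nhdsWithin (0:ℝ) (Set.Iio (0:ℝ))) (nhds (φ (0 : EuclideanSpace ℝ (Fin 3))))) ∧ (∃ c₁ c₂ C₁ C₂ : ℝ, 0 < c₁ ∧ 0 < c₂ ∧ 0 < C₁ ∧ 0 < C₂ ∧ ∀ t ∈ Set.Iio (0:ℝ), ∀ x, c₁ * ((0:ℝ) - t) ^ (-(3:ℝ) / 2) * Real.exp (-(‖x - (0 : EuclideanSpace ℝ (Fin 3))‖ ^ 2) / (c₂ * ((0:ℝ) - t))) ≤ K t x ∧ K t x ≤ C₁ * ((0:ℝ) - t) ^ (-(3:ℝ) / 2) * Real.exp (-(‖x - (0 : EuclideanSpace ℝ (Fin 3))‖ ^ 2) / (C₂ * ((0:ℝ) - t)))) ∧ (∀ H Λ : ℝ → ℝ, H = (fun t => ∫ x, ‖Literature.Analysis.FluidPDE.curl (v t) x‖ ^ 2 * K t x) → Λ = (fun t => (0 - t) * deriv H t / H t) → (∀ t ∈ Set.Iio (0:ℝ), 0 < H t) ∧ (∀ t ∈ Set.Iio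 (0:ℝ), Λ t = Λ₀))) ∧ (∃ (B : ℝ → EuclideanSpace ℝ (Fin 3)) (C_B : ℝ), ContDiffOn ℝ (⊤ : ℕ∞) B (Set.Iio (0:ℝ)) ∧ (∀ t < (0:ℝ), ‖deriv B t‖ ≤ C_B / Real.sqrt (-t)) ∧ Filter.Tendsto B (nhdsWithin (0:ℝ) (Set.Iio (0:ℝ))) (nhds (0 : EuclideanSpace ℝ (Fin 3))) ∧ Literature.Analysis.FluidPDE.typeIBound (Set.Iio (0:ℝ) ×ˢ Set.univ) (fun t x => v t (x - B t) + deriv B t) (fun t x => q t (x - B t) - inner ℝ (deriv (deriv B) t) x) (fun t x => fderiv ℝ (v t) (x - B t)) < ⊤)) := by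
  intro h0
  rintro ⟨ν, C, Λ₀, v, q, K, hbody, B, C_B, hB, hB', hB0, hI⟩
  obtain ⟨hν, hNS, hTI, hKc, hCmp, hF⟩ := (body_iff_bundles ν C Λ₀ v q K).1 hbody
  have hW := witness_wobble (B := B) hν hNS hTI hKc hCmp hF hB hB' hB0
  refine h0 ⟨ν, C + C_B, Λ₀, wobbleDrift v B (deriv B), wobblePressure q B, wobbleKernel K B,
    (body_iff_bundles ν (C + C_B) Λ₀ _ _ _).2 hW, ?_⟩
  have hG : (fun t x => fderiv ℝ (wobbleDrift v B (deriv B) t) x) =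
      fun t x => fderiv ℝ (v t) (x - B t) := by
    funext t x; exact fderiv_wobbleDrift v B (deriv B) t x
  rw [hG]
  exact hI

end Summit.NavierStokesRegularity.NavierStokesRegularity.Theorems.FrequencyRigidity.ScaledEnergySplit

end
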